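import Literature.Topology.FourManifolds.MorseHandleNormalDatum
import Literature.Topology.FourManifolds.MorseSublevelHomologyCoeff
import Literature.Topology.FourManifolds.SlabSublevelHomologyCoeff
import Literature.Topology.FourManifolds.MorseCountClosed
import Literature.Topology.FourManifolds.RegularSublevelDeformation
import Literature.Topology.FourManifolds.MorseAffine
import Literature.Topology.FourManifolds.MorseHomologyVanishing
import Literature.Topology.FourManifolds.HCobordismDiscBasis
import Literature.Topology.FourManifolds.HCobordismSlideStepCellLocalisation
import Literature.AlgebraicTopology.SingularHomology.NormalCoordinateCollapse
import Literature.AlgebraicTopology.SingularHomology.CellCentreLocalisation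
import Mathlib.Topology.Metrizable.Urysohn
import HarnessLib

/-!
# The collapse maps of the right-hand discs detect `H_k` of the handlebody of a nice Morse
# function on a closed manifold

Topic `Literature/Topology/FourManifolds`.  The Morse-theoretic core of the rigidity of natural
de Rham comparisons (`Literature.AlgebraicGeometry.HodgeTheory.NaturalDeRhamComparisonRigidity`).
Let `X` be a closed `(n+1)`-manifold, `g` a nice (self-indexing) Morse function on the cobordism
`(X; ∅, ∅)` (Milnor, *Lectures on the h-cobordism theorem* (1965), Def. 4.9), `1 ≤ k ≤ n`, and
`U = {g < cutLevel n (k + 1)}` the open handlebody of the handles of index `≤ k`.  For each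
critical point `p` of index `k` the collapse `γ_p : U → ℝᵏ ∪ {∞}` of the normal coordinate of
its right-hand disc (`MorseHandleNormalDatum.lean`, `NormalCoordinateCollapse.lean`; Thom 1954,
Ch. II) is defined, and we prove, for homology with coefficients in a field `F`:

**`Cobordism.IsNiceMorseFunction.exists_map_collapse_ne_zero`: every non-zero class of
`H_k(U; F)` has a non-zero image under some `(γ_p)⁎ : H_k(U; F) → H_k(ℝᵏ ∪ {∞}; F)`.**

This is Milnor's computation of `C_k = H_k(W_k, W_{k-1})` by the left-hand discs (Cor. 3.15,
Thm. 7.6: *"a basis represented by the left-hand disks `D_L(p₁), …, D_L(p_k)`"*; the tree's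
`Cobordism.exists_basis_leftHandDiscs_slab`) together with his Lemmas 6.3 / 7.2 (*"`D_R(pᵢ)` and
`D_L(p_j)` intersect in one point, transversely, `δᵢⱼ`"*), in homological form:
`H_k(U) ↪ H_k(U, W_{k-1})` (`H_k(W_{k-1}) = 0`), `H_k(U, W_{k-1}) ↪ H_k(W_k, W_{k-1})` (the
inclusion `U ↪ W_k` is a homotopy equivalence, collar flow, Milnor 1963 Thm. 3.1), the disc
classes span, the collapse of `D_R(p)` kills the discs `D_L(q)`, `q ≠ p`, and is an isomorphism on
the local homology of `D_L(p)` at `p` (`TransverseDiscDatum.isIso_localHomology_map_collapse`).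

Also recorded: the inclusion `{f < b} → {f ≤ b}` of a regular sublevel set is an isomorphism on
homology (`bijective_map_inclusion_sublevel_lt`), and the localisation
`H_k(D_L, S_L) → H_k(D_L | v)` is bijective for any coefficients
(`Cobordism.bijective_localisation_leftHandDisc`, the tree's integral
`Cobordism.isGenerator_localisation_leftHandDisc`).  Everything is proved; the only definition is
the auxiliary structure `HandleCollapse` bundling a collapse map with its two properties.

## References

* J. Milnor, *Lectures on the h-cobordism theorem*, notes by L. Siebenmann and J. Sondow,
  Princeton Mathematical Notes (1965): Thm. 3.14, Cor. 3.15 (PDF pp. 19–21), Def. 4.9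
  (PDF p. 25), Lemma 6.3 (PDF p. 37), Lemma 7.2, Thm. 7.6 (PDF pp. 46–50). [MilnorHCobordism1965]
* J. Milnor, *Morse theory*, Ann. of Math. Studies 51 (1963), Thm. 3.1. [Milnor1963]
* R. Thom, *Quelques propriétés globales des variétés différentiables*, Comment. Math. Helv. 28
  (1954), Ch. II. [ThomCMH1954]
* A. Hatcher, *Algebraic Topology*, CUP 2002, §2.1 pp. 117–118 (exact sequences of pairs and
  triples, naturality), Thm. 2.20, §3.3 p. 236. [HatcherAT2002]
-/

open scoped Manifold ContDiff Topology
open Set Function Filter Metric CategoryTheory Limits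
open Literature.AlgebraicTopology.SingularHomology Literature.AlgebraicTopology.Homotopy

noncomputable section

namespace Literature.Topology.FourManifolds

universe u v

variable (R : Type v) [CommRing R] (M₀ : Type v) [AddCommGroup M₀] [Module R M₀]

/-! ### Three pieces of homological algebra of pairs -/

section Pairs

variable {X Y : Type u} [TopologicalSpace X] [TopologicalSpace Y]

/-- **`Hₙ(X) → Hₙ(X, A)` is injective if `Hₙ(A) = 0`** (exactness of `Hₙ(A) → Hₙ(X) → Hₙ(X, A)`,
Hatcher 2002, §2.1 p. 117). [cite: HatcherAT2002, §2.1 p. 117] -/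
theorem injective_ofAbsolute_of_isZero (A : Set X) (n : ℕ)
    (hA : IsZero (singularHomology R M₀ ↥A n)) :
    Function.Injective (relativeSingularHomology.ofAbsolute R M₀ X A n) := by
  have hex := relativeSingularHomology.exact_map_ofAbsolute R M₀ A n
  rw [ShortComplex.moduleCat_exact_iff_range_eq_ker] at hex
  rw [← LinearMap.ker_eq_bot, ← hex, LinearMap.range_eq_bot]
  change (singularHomology.map R M₀ (⟨Subtype.val, continuous_subtype_val⟩ : C(↥A, X)) n).hom = 0
  rw [hA.eq_of_src (singularHomology.map R M₀ (⟨Subtype.val, continuous_subtype_val⟩ : C(↥A, X)) n) 0]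
  rfl

/-- **A map of pairs whose image lies in the subspace is zero on relative homology**: if
`f(X) ⊆ B` then `f⁎ : Hₙ(X, A) → Hₙ(Y, B)` vanishes, since it factors through `Hₙ(B, B) = 0`.
[cite: HatcherAT2002, §2.1 (Hₙ(X, X) = 0)] -/
theorem relativeSingularHomology.map_eq_zero_of_mapsTo_univ {A : Set X} {B : Set Y} (f : C(X, Y))
    (h : MapsTo f A B) (hB : MapsTo f univ B) (n : ℕ) :
    relativeSingularHomology.map R M₀ f h n = 0 := by
  let f' : C(X, ↥B) := ⟨fun x => ⟨f x, hB (mem_univ x)⟩, f.continuous.subtype_mk _⟩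
  have hf' : MapsTo f' A (Subtype.val ⁻¹' B) := fun x _ => hB (mem_univ x)
  have hfac : relativeSingularHomology.map R M₀ f h n =
      relativeSingularHomology.map R M₀ f' hf' n ≫
        relativeSingularHomology.map R M₀ (subsetIncl B) (mapsTo_preimage Subtype.val B) n := by
    rw [← relativeSingularHomology.map_comp]
    rfl
  rw [hfac]
  have h0 := relativeSingularHomology.isZero_preimage_self R M₀ B n
  rw [h0.eq_of_src (relativeSingularHomology.map R M₀ (subsetIncl B) (mapsTo_preimage Subtype.val B) n) 0,
    comp_zero]

/-- **A four-lemma for maps of pairs**: for a map of pairs `f : (X, A) → (Y, B)`, if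
`f⁎ : Hₙ₊₁(X) → Hₙ₊₁(Y)` and `(f|_A)⁎ : Hₙ(A) → Hₙ(B)` are injective and `Hₙ₊₁(B) = 0`, then
`f⁎ : Hₙ₊₁(X, A) → Hₙ₊₁(Y, B)` is injective (diagram chase in the exact sequences of the two pairs,
Hatcher 2002, §2.1 pp. 117, 127). [cite: HatcherAT2002, §2.1 pp. 117, 127 (naturality of the exact sequence of a pair)] -/
theorem relativeSingularHomology.injective_map_of_injective {A : Set X} {B : Set Y} (f : C(X, Y))
    (h : MapsTo f A B) (n : ℕ)
    (hf : Function.Injective (singularHomology.map R M₀ f (n + 1)))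
    (hfA : Function.Injective (singularHomology.map R M₀ (subsetRestrict f h) n))
    (hB : IsZero (singularHomology R M₀ ↥B (n + 1))) :
    Function.Injective (relativeSingularHomology.map R M₀ f h (n + 1)) := by
  rw [← LinearMap.ker_eq_bot, LinearMap.ker_eq_bot']
  intro y hy
  change (relativeSingularHomology.map R M₀ f h (n + 1)) y = 0 at hy
  -- `δ y = 0`
  have hδ : relativeSingularHomology.δ R M₀ X A n y = 0 := by
    apply hfA
    rw [map_zero, ← ModuleCat.comp_apply, relativeSingularHomology.δ_naturality, ModuleCat.comp_apply,
      hy, map_zero]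
  -- `y = j⁎ x`
  have hex := relativeSingularHomology.exact_ofAbsolute_δ R M₀ A n
  rw [ShortComplex.moduleCat_exact_iff_range_eq_ker] at hex
  have hy' : y ∈ LinearMap.ker (relativeSingularHomology.δ R M₀ X A n).hom := hδ
  rw [← hex] at hy'
  obtain ⟨x, rfl⟩ := hy'
  -- `f⁎ x ↦ 0` in `Hₙ₊₁(Y, B)`, so `f⁎ x` comes from `Hₙ₊₁(B) = 0`
  have h1 : relativeSingularHomology.ofAbsolute R M₀ Y B (n + 1) (singularHomology.map R M₀ f (n + 1) x) = 0 := by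
    rw [← ModuleCat.comp_apply, ← relativeSingularHomology.ofAbsolute_comp_map, ModuleCat.comp_apply]
    exact hy
  have h2 := injective_ofAbsolute_of_isZero R M₀ B (n + 1) hB
  have h3 : singularHomology.map R M₀ f (n + 1) x = 0 := h2 (by rw [h1, map_zero])
  have h4 : x = 0 := hf (by rw [h3, map_zero])
  change (relativeSingularHomology.ofAbsolute R M₀ X A (n + 1)) x = 0
  rw [h4, map_zero]

end Pairs

/-! ### The inclusion of the open sublevel set into the closed one at a regular value -/

section Sublevel

variable {E : Type u} [NormedAddCommGroup E] [NormedSpace ℝ E] [FiniteDimensional ℝ E]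
  {H : Type u} [TopologicalSpace H] {IM : ModelWithCorners ℝ E H} [IM.Boundaryless]
  {M : Type u} [TopologicalSpace M] [ChartedSpace H M] [IsManifold IM ∞ M]
  [T2Space M] [SecondCountableTopology M] [CompactSpace M]

/-- **The inclusion `{f < b} ↪ {f ≤ b}` of a regular sublevel set of a compact manifold without
boundary is a homotopy equivalence** (Milnor 1963, Thm. 3.1: pushing in along the collar flow;
the tree's `nonempty_homotopyEquiv_sublevel_lt`, restated so as to name the inclusion): there is a
homotopy equivalence whose inverse map is the inclusion. [cite: Milnor1963, Thm. 3.1] -/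
theorem exists_homotopyEquiv_sublevel_lt_invFun_eq {f : M → ℝ} (hf : ContMDiff IM 𝓘(ℝ, ℝ) ∞ f)
    {b : ℝ} (hreg : ∀ x, f x = b → mfderiv IM 𝓘(ℝ, ℝ) f x ≠ 0) :
    ∃ e : ContinuousMap.HomotopyEquiv {x : M // f x ≤ b} {x : M // f x < b},
      ⇑e.invFun = fun x => ⟨x.1, le_of_lt x.2⟩ := by
  -- the collar flow of `f - b`
  have hf' : ContMDiff IM 𝓘(ℝ, ℝ) ∞ (fun x => f x - b) := hf.sub contMDiff_const
  have hreg' : ∀ x, f x - b = 0 → mfderiv IM 𝓘(ℝ, ℝ) (fun x => f x - b) x ≠ 0 := by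
    intro x hx
    have hfx : f x = b := by linarith
    have hd : MDifferentiableAt IM 𝓘(ℝ, ℝ) f x := hf.mdifferentiableAt (by simp)
    have : mfderiv IM 𝓘(ℝ, ℝ) (fun x => f x - b) x = mfderiv IM 𝓘(ℝ, ℝ) f x := by
      have h1 : (fun x => f x - b) = fun x => 1 * f x + -b := by funext y; ring
      rw [h1, mfderiv_const_mul_add 1 (-b) hd, one_smul]
    rw [this]
    exact hreg x hfx
  obtain ⟨η, hη, θ, hθc, hθ0, -, hmono, hcollar⟩ := exists_collarFlow hf' hreg'
  -- pushing in does not increase `f`, and strictly decreases it from the level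
  have hle : ∀ (x : M) (s : ℝ), 0 ≤ s → f (θ (-s, x)) ≤ f x := fun x s hs ↦ by
    have h := hmono x (neg_nonpos.2 hs)
    simp only [hθ0] at h
    linarith
  have hlt : ∀ x : M, f x ≤ b → f (θ (-(η / 2), x)) < b := by
    intro x hx
    rcases hx.lt_or_eq with h | h
    · exact lt_of_le_of_lt (hle x (η / 2) (by positivity)) h
    · have h1 : f x - b ∈ Icc (-η) η := by rw [h]; constructor <;> linarith
      have h2 : f x - b + -(η / 2) ∈ Icc (-η) η := by rw [h]; constructor <;> linarith
      have := hcollar x (-(η / 2)) h1 h2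
      rw [h] at this
      linarith
  have hpush : ∀ {p : M → Prop}, Continuous fun q : unitInterval × {x : M // p x} ↦
      θ (-(η / 2) * (1 - (q.1 : ℝ)), (q.2 : M)) := by
    intro p
    refine hθc.comp (Continuous.prodMk ?_ (continuous_subtype_val.comp continuous_snd))
    exact continuous_const.mul
      (continuous_const.sub (continuous_subtype_val.comp continuous_fst))
  have hcoef : ∀ s : unitInterval, 0 ≤ (η / 2) * (1 - (s : ℝ)) := fun s ↦
    mul_nonneg (by positivity) (sub_nonneg.2 s.2.2)
  let j : C({x : M // f x ≤ b}, {x : M // f x < b}) :=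
    ⟨fun x ↦ ⟨θ (-(η / 2), x), hlt x x.2⟩,
      (hθc.comp (continuous_const.prodMk continuous_subtype_val)).subtype_mk _⟩
  let i : C({x : M // f x < b}, {x : M // f x ≤ b}) :=
    ⟨fun x ↦ ⟨x, x.2.le⟩, continuous_subtype_val.subtype_mk _⟩
  have hmem₁ : ∀ q : unitInterval × {x : M // f x ≤ b},
      f (θ (-(η / 2) * (1 - (q.1 : ℝ)), (q.2 : M))) ≤ b := fun q ↦ by
    have h := hle (q.2 : M) ((η / 2) * (1 - (q.1 : ℝ))) (hcoef q.1)
    rw [neg_mul]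
    exact h.trans q.2.2
  have hmem₂ : ∀ q : unitInterval × {x : M // f x < b},
      f (θ (-(η / 2) * (1 - (q.1 : ℝ)), (q.2 : M))) < b := fun q ↦ by
    have h := hle (q.2 : M) ((η / 2) * (1 - (q.1 : ℝ))) (hcoef q.1)
    rw [neg_mul]
    exact lt_of_le_of_lt h q.2.2
  let F₁ : (i.comp j).Homotopy (ContinuousMap.id {x : M // f x ≤ b}) :=
    { toFun := fun q ↦ ⟨θ (-(η / 2) * (1 - (q.1 : ℝ)), (q.2 : M)), hmem₁ q⟩
      continuous_toFun := hpush.subtype_mk _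
      map_zero_left := fun x ↦ by
        apply Subtype.ext
        simp [i, j]
      map_one_left := fun x ↦ by
        apply Subtype.ext
        simp [hθ0] }
  let F₂ : (j.comp i).Homotopy (ContinuousMap.id {x : M // f x < b}) :=
    { toFun := fun q ↦ ⟨θ (-(η / 2) * (1 - (q.1 : ℝ)), (q.2 : M)), hmem₂ q⟩
      continuous_toFun := hpush.subtype_mk _
      map_zero_left := fun x ↦ by
        apply Subtype.ext
        simp [i, j]
      map_one_left := fun x ↦ by
        apply Subtype.ext
        simp [hθ0] }
  exact ⟨⟨j, i, ⟨F₁⟩, ⟨F₂⟩⟩, rfl⟩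

/-- **The inclusion `{f < b} → {f ≤ b}` of a regular sublevel set is an isomorphism on singular
homology** (any coefficients): it is a homotopy equivalence (Milnor 1963, Thm. 3.1) and homology is
homotopy invariant (Hatcher 2002, Cor. 2.11). [cite: Milnor1963, Thm. 3.1] [cite: HatcherAT2002, Cor. 2.11] -/
theorem bijective_map_inclusion_sublevel_lt {f : M → ℝ} (hf : ContMDiff IM 𝓘(ℝ, ℝ) ∞ f)
    {b : ℝ} (hreg : ∀ x, f x = b → mfderiv IM 𝓘(ℝ, ℝ) f x ≠ 0) (n : ℕ) :
    Function.Bijective (singularHomology.map R M₀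
      (⟨fun x => ⟨x.1, le_of_lt x.2⟩, continuous_subtype_val.subtype_mk _⟩ :
        C({x : M // f x < b}, {x : M // f x ≤ b})) n) := by
  obtain ⟨e, he⟩ := exists_homotopyEquiv_sublevel_lt_invFun_eq hf hreg
  have h : (⟨fun x => ⟨x.1, le_of_lt x.2⟩, continuous_subtype_val.subtype_mk _⟩ :
      C({x : M // f x < b}, {x : M // f x ≤ b})) = e.invFun := ContinuousMap.ext fun x => by
    rw [he]; rfl
  rw [h]
  exact (singularHomology.isoOfHomotopyEquiv R M₀ e n).symm.toLinearEquiv.bijective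

end Sublevel

/-! ### The localisation of the disc class of a left-hand disc at an interior point -/

namespace Cobordism

variable {n : ℕ} {M N : Type u} [TopologicalSpace M] [T2Space M] [SecondCountableTopology M]
  [ChartedSpace ((EuclideanSpace ℝ (Fin n))) M] [IsManifold (𝓡 n) ∞ M] [CompactSpace M]
  [TopologicalSpace N] [T2Space N] [SecondCountableTopology N] [ChartedSpace ((EuclideanSpace ℝ (Fin n))) N]
  [IsManifold (𝓡 n) ∞ N] [CompactSpace N]

/-- **`H_k(D_L(p), S_L(p); M₀) → H_k(D_L(p) | v; M₀)` is bijective** at every point `v` of the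
left-hand disc off the bottom level `a₀` (any coefficients): the disc is an embedded closed
`k`-cell bounded by `S_L(p) = D_L(p) ∩ f⁻¹(a₀)` (Def. 3.9, `Cobordism.Milnor1965_leftHandDisc_isDisc_holds`)
and `H_k(D, ∂D) → H_k(D | v)` is bijective at interior points (Hatcher 2002, §3.3 p. 236,
`bijective_map_parametrizedDisc_boundary_compl`).  The integral statement about generators is
the tree's `Cobordism.isGenerator_localisation_leftHandDisc`, whose proof this follows.
[cite: MilnorHCobordism1965, Def. 3.9 (PDF p. 16)] [cite: HatcherAT2002, §3.3 p. 236] -/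
theorem bijective_localisation_leftHandDisc {c : Cobordism n M N} {f : c.W → ℝ}
    (hf : c.IsMorseFunction f)
    (ξ : Cₛ^∞⟮𝓡∂ (n + 1); EuclideanSpace ℝ (Fin (n + 1)), (TangentSpace (𝓡∂ (n + 1)) : c.W → Type)⟯)
    (hξ : IsGradientLike (𝓡∂ (n + 1)) f ξ) {a₀ : ℝ} (ha₀ : 0 ≤ a₀) {p : c.W} {k : ℕ}
    (hp : p ∈ criticalSetOfIndex (𝓡∂ (n + 1)) f k) (ha₀p : a₀ < f p)
    (hnoval : ∀ z ∈ criticalSet (𝓡∂ (n + 1)) f, f z ∉ Ico a₀ (f p))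
    (v : ↥(leftHandDisc (𝓡∂ (n + 1)) f ξ p a₀)) (hv : f v.1 ≠ a₀) (i : ℕ) :
    Function.Bijective (relativeSingularHomology.map R M₀
      (ContinuousMap.id ↥(leftHandDisc (𝓡∂ (n + 1)) f ξ p a₀))
      (mapsTo_id_leftHandSphere_compl v hv) i) := by
  classical
  -- the cell structure of `D_L(p)`
  obtain ⟨Φ₀, hΦinj, hΦrange, hΦlev⟩ :=
    Cobordism.Milnor1965_leftHandDisc_isDisc_holds hf ξ hξ ha₀ hp.1 ha₀p hnoval
  obtain ⟨Φ, hrange, hinj, hlev⟩ := exists_cell_of_dim_eq hp.2 Φ₀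
  have hΦi : Injective Φ := hinj hΦinj
  have hΦl : ∀ x, f (Φ x) = a₀ ↔ ‖(x : EuclideanSpace ℝ (Fin k))‖ = 1 := hlev (f ⁻¹' {a₀}) hΦlev
  rw [hΦrange] at hrange
  obtain ⟨m, hm⟩ : ∃ m : EuclideanSpace ℝ (Fin k) → c.W, m = fun w =>
      if hw : w ∈ closedBall (0 : EuclideanSpace ℝ (Fin k)) 1 then Φ ⟨w, hw⟩
      else Φ ⟨0, mem_closedBall_self zero_le_one⟩ := ⟨_, rfl⟩
  have hmw : ∀ (w : EuclideanSpace ℝ (Fin k)) (hw : w ∈ closedBall (0 : EuclideanSpace ℝ (Fin k)) 1),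
      m w = Φ ⟨w, hw⟩ := fun w hw => by rw [hm]; simp only [dif_pos hw]
  have hmc : ContinuousOn m (closedBall 0 1) := by
    rw [continuousOn_iff_continuous_restrict]
    have : (closedBall (0 : EuclideanSpace ℝ (Fin k)) 1).restrict m = fun w => Φ w :=
      funext fun w => hmw w w.2
    rw [this]
    exact Φ.continuous
  have hmi : InjOn m (closedBall 0 1) := by
    intro w hw w' hw' hww'
    rw [hmw w hw, hmw w' hw'] at hww'
    exact congrArg Subtype.val (hΦi hww')
  have hE : m '' closedBall 0 1 = leftHandDisc (𝓡∂ (n + 1)) f ξ p a₀ := by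
    rw [← hrange]
    ext z
    constructor
    · rintro ⟨w, hw, rfl⟩
      rw [hmw w hw]; exact mem_range_self _
    · rintro ⟨w, rfl⟩
      exact ⟨w, w.2, hmw w w.2⟩
  have hS : ∀ z ∈ m '' closedBall (0 : EuclideanSpace ℝ (Fin k)) 1,
      z ∈ m '' sphere 0 1 ↔ z ∈ leftHandSphere (𝓡∂ (n + 1)) f ξ p a₀ := by
    rintro z ⟨w, hw, rfl⟩
    rw [hmw w hw]
    have hzD : Φ ⟨w, hw⟩ ∈ leftHandDisc (𝓡∂ (n + 1)) f ξ p a₀ := by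
      rw [← hrange]; exact mem_range_self _
    constructor
    · rintro ⟨w', hw', hw'z⟩
      rw [hmw w' (sphere_subset_closedBall hw')] at hw'z
      have hww : (⟨w', sphere_subset_closedBall hw'⟩ : ↥(closedBall (0 : EuclideanSpace ℝ (Fin k)) 1)) =
          ⟨w, hw⟩ := hΦi hw'z
      have hw1 : ‖w‖ = 1 := by
        have := mem_sphere_zero_iff_norm.1 hw'
        rwa [show w' = w from congrArg Subtype.val hww] at this
      exact ⟨hzD.1, (hΦl ⟨w, hw⟩).2 hw1⟩
    · intro hz
      exact ⟨w, mem_sphere_zero_iff_norm.2 ((hΦl ⟨w, hw⟩).1 hz.2), hmw w hw⟩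
  -- the point `v` is `m x₀` with `‖x₀‖ < 1`
  have hvD : (v : c.W) ∈ range Φ := by rw [hrange]; exact v.2
  obtain ⟨x₀, hx₀⟩ := hvD
  have hx₀n : (x₀ : EuclideanSpace ℝ (Fin k)) ∈ ball (0 : EuclideanSpace ℝ (Fin k)) 1 := by
    refine mem_ball_zero_iff.2 (lt_of_le_of_ne (mem_closedBall_zero_iff.1 x₀.2) fun h1 => ?_)
    have := (hΦl x₀).2 h1
    rw [hx₀] at this
    exact hv this
  have hmx₀ : m x₀ = v := by rw [hmw x₀ x₀.2]; exact hx₀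
  -- the tautological homeomorphism of pairs `E ≅ D`, and the two localisations
  let ed : ↥(m '' closedBall (0 : EuclideanSpace ℝ (Fin k)) 1) ≃ₜ ↥(leftHandDisc (𝓡∂ (n + 1)) f ξ p a₀) :=
    Homeomorph.setCongr hE
  have hed : MapsTo (ed : C(↥(m '' closedBall (0 : EuclideanSpace ℝ (Fin k)) 1), ↥(leftHandDisc (𝓡∂ (n + 1)) f ξ p a₀)))
      (Subtype.val ⁻¹' (m '' sphere 0 1)) (Subtype.val ⁻¹' leftHandSphere (𝓡∂ (n + 1)) f ξ p a₀) :=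
    fun z hz => (hS z z.2).1 hz
  set w₀ : ↥(m '' closedBall (0 : EuclideanSpace ℝ (Fin k)) 1) :=
    ⟨m x₀, mem_image_of_mem m (ball_subset_closedBall hx₀n)⟩ with hw₀
  have hedw : ed w₀ = v := Subtype.ext hmx₀
  have hedv : MapsTo (ed : C(↥(m '' closedBall (0 : EuclideanSpace ℝ (Fin k)) 1), ↥(leftHandDisc (𝓡∂ (n + 1)) f ξ p a₀)))
      ({w₀}ᶜ : Set _) ({v}ᶜ : Set ↥(leftHandDisc (𝓡∂ (n + 1)) f ξ p a₀)) := by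
    intro z hz h
    apply hz
    rw [mem_singleton_iff] at h ⊢
    have h' : ed z = v := h
    apply ed.injective
    rw [h', hedw]
  have hedv' : MapsTo (ed.symm : C(↥(leftHandDisc (𝓡∂ (n + 1)) f ξ p a₀), ↥(m '' closedBall (0 : EuclideanSpace ℝ (Fin k)) 1)))
      ({v}ᶜ : Set ↥(leftHandDisc (𝓡∂ (n + 1)) f ξ p a₀)) ({w₀}ᶜ : Set _) := by
    intro z hz h
    apply hz
    rw [mem_singleton_iff] at h ⊢
    have h' : ed.symm z = w₀ := h
    rw [← ed.apply_symm_apply z, h', hedw]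
  -- the boundary of the cell misses `w₀`
  have hw₀S : w₀ ∉ (Subtype.val ⁻¹' (m '' sphere 0 1) : Set ↥(m '' closedBall (0 : EuclideanSpace ℝ (Fin k)) 1)) := by
    intro h
    have h1 := (hS _ w₀.2).1 h
    rw [hw₀] at h1
    change m x₀ ∈ leftHandSphere (𝓡∂ (n + 1)) f ξ p a₀ at h1
    rw [hmx₀] at h1
    exact hv h1.2
  have hloc : MapsTo (ContinuousMap.id ↥(m '' closedBall (0 : EuclideanSpace ℝ (Fin k)) 1))
      (Subtype.val ⁻¹' (m '' sphere 0 1)) ({w₀}ᶜ : Set _) := by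
    intro z hz h
    rw [ContinuousMap.id_apply, mem_singleton_iff] at h
    exact hw₀S (h ▸ hz)
  -- the model statement, and the commuting square `loc ∘ ed = ed ∘ loc`
  have hbij := bijective_map_parametrizedDisc_boundary_compl R M₀ m one_pos hmc hmi hx₀n i hloc
  have hsq : relativeSingularHomology.map R M₀
      (ed : C(↥(m '' closedBall (0 : EuclideanSpace ℝ (Fin k)) 1), ↥(leftHandDisc (𝓡∂ (n + 1)) f ξ p a₀))) hed i ≫
      relativeSingularHomology.map R M₀ (ContinuousMap.id ↥(leftHandDisc (𝓡∂ (n + 1)) f ξ p a₀))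
        (mapsTo_id_leftHandSphere_compl v hv) i =
      relativeSingularHomology.map R M₀ (ContinuousMap.id ↥(m '' closedBall (0 : EuclideanSpace ℝ (Fin k)) 1)) hloc i ≫
        relativeSingularHomology.map R M₀
          (ed : C(↥(m '' closedBall (0 : EuclideanSpace ℝ (Fin k)) 1), ↥(leftHandDisc (𝓡∂ (n + 1)) f ξ p a₀))) hedv i := by
    rw [← relativeSingularHomology.map_comp, ← relativeSingularHomology.map_comp]
    rfl
  -- `ed` on the two pairs is bijective (homeomorphism of pairs)
  have hed' : MapsTo (ed.symm : C(↥(leftHandDisc (𝓡∂ (n + 1)) f ξ p a₀), ↥(m '' closedBall (0 : EuclideanSpace ℝ (Fin k)) 1)))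
      (Subtype.val ⁻¹' leftHandSphere (𝓡∂ (n + 1)) f ξ p a₀) (Subtype.val ⁻¹' (m '' sphere 0 1)) :=
    fun z hz => (hS (ed.symm z) (ed.symm z).2).2 hz
  haveI := relativeSingularHomology.isIso_map_homeomorph R M₀ ed hed hed' i
  haveI := relativeSingularHomology.isIso_map_homeomorph R M₀ ed hedv hedv' i
  have hb1 := (asIso (relativeSingularHomology.map R M₀
    (ed : C(↥(m '' closedBall (0 : EuclideanSpace ℝ (Fin k)) 1), ↥(leftHandDisc (𝓡∂ (n + 1)) f ξ p a₀))) hed i)).toLinearEquiv.bijective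
  have hb2 := (asIso (relativeSingularHomology.map R M₀
    (ed : C(↥(m '' closedBall (0 : EuclideanSpace ℝ (Fin k)) 1), ↥(leftHandDisc (𝓡∂ (n + 1)) f ξ p a₀))) hedv i)).toLinearEquiv.bijective
  -- conclude from the square
  have hpt : ∀ y, relativeSingularHomology.map R M₀ (ContinuousMap.id ↥(leftHandDisc (𝓡∂ (n + 1)) f ξ p a₀))
        (mapsTo_id_leftHandSphere_compl v hv) i
      (relativeSingularHomology.map R M₀
        (ed : C(↥(m '' closedBall (0 : EuclideanSpace ℝ (Fin k)) 1), ↥(leftHandDisc (𝓡∂ (n + 1)) f ξ p a₀))) hed i y) =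
      relativeSingularHomology.map R M₀
        (ed : C(↥(m '' closedBall (0 : EuclideanSpace ℝ (Fin k)) 1), ↥(leftHandDisc (𝓡∂ (n + 1)) f ξ p a₀))) hedv i
      (relativeSingularHomology.map R M₀ (ContinuousMap.id ↥(m '' closedBall (0 : EuclideanSpace ℝ (Fin k)) 1)) hloc i y) := by
    intro y
    have := LinearMap.congr_fun (congrArg ModuleCat.Hom.hom hsq) y
    simpa only [ModuleCat.hom_comp, LinearMap.coe_comp, comp_apply] using this
  have hcomp₁ : Function.Bijective ((relativeSingularHomology.map R M₀ (ContinuousMap.id ↥(leftHandDisc (𝓡∂ (n + 1)) f ξ p a₀))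
        (mapsTo_id_leftHandSphere_compl v hv) i) ∘ (relativeSingularHomology.map R M₀
        (ed : C(↥(m '' closedBall (0 : EuclideanSpace ℝ (Fin k)) 1), ↥(leftHandDisc (𝓡∂ (n + 1)) f ξ p a₀))) hed i)) := by
    have heq : ((relativeSingularHomology.map R M₀ (ContinuousMap.id ↥(leftHandDisc (𝓡∂ (n + 1)) f ξ p a₀))
        (mapsTo_id_leftHandSphere_compl v hv) i) ∘ (relativeSingularHomology.map R M₀
        (ed : C(↥(m '' closedBall (0 : EuclideanSpace ℝ (Fin k)) 1), ↥(leftHandDisc (𝓡∂ (n + 1)) f ξ p a₀))) hed i)) =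
        (relativeSingularHomology.map R M₀
          (ed : C(↥(m '' closedBall (0 : EuclideanSpace ℝ (Fin k)) 1), ↥(leftHandDisc (𝓡∂ (n + 1)) f ξ p a₀))) hedv i) ∘
        (relativeSingularHomology.map R M₀ (ContinuousMap.id ↥(m '' closedBall (0 : EuclideanSpace ℝ (Fin k)) 1)) hloc i) :=
      funext fun y => hpt y
    rw [heq]
    exact hb2.comp hbij
  have hb1' : Function.Bijective (relativeSingularHomology.map R M₀
      (ed : C(↥(m '' closedBall (0 : EuclideanSpace ℝ (Fin k)) 1), ↥(leftHandDisc (𝓡∂ (n + 1)) f ξ p a₀))) hed i) := hb1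
  exact (Function.Bijective.of_comp_iff _ hb1').1 hcomp₁

end Cobordism

/-! ### Detection data at a critical point (spaces in `Type`: they map to `ℝᵏ ∪ {∞}`) -/

namespace Cobordism

variable {n : ℕ} {M N : Type} [TopologicalSpace M] [ChartedSpace (EuclideanSpace ℝ (Fin n)) M]
  [TopologicalSpace N] [ChartedSpace (EuclideanSpace ℝ (Fin n)) N]

/-- **Detection data at a critical point `p` of index `k`** of a Morse function `g` with
gradient-like field `ξ`, on the open handlebody `U = {g < cutLevel n (k + 1)}`: a transverse disc
datum `T` on `U` (stratum `P`, normal coordinate `K`, transverse disc `m` centred at `p` with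
`K ∘ m = id`, lying in the stable set `D_L(p)` of `p` and a neighbourhood of `p` there, and
`D_L(p) ∩ P = {p}`), a collapse map `γ : U → ℝᵏ ∪ {∞}` of it (`γ = β ∘ K` near `P`,
`γ⁻¹(↑0) = P`), and the two disjointness properties of the stratum: it misses
`{g ≤ cutLevel n k}` and the stable sets of the other critical points on the level of `p`.  For
`k ≤ n` these are the right-hand disc data of `MorseHandleNormalDatum.lean`
(`HandleNormalDatum.detectionDatum`); for `k = n + 1` (maxima) a chart about `p` provides them.
[cite: MilnorHCobordism1965, Def. 3.9 (PDF p. 16), Lemma 6.3 (PDF p. 37), Lemma 7.2 (PDF pp. 46–47)] [cite: ThomCMH1954, Ch. II] -/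
structure DetectionDatum (c : Cobordism n M N) (g : c.W → ℝ)
    (ξ : Π x : c.W, TangentSpace (𝓡∂ (n + 1)) x) (k : ℕ) (p : c.W) where
  /-- the transverse disc datum on `U` -/
  T : TransverseDiscDatum ↥{z : c.W | g z < cutLevel n (k + 1)} k
  /-- the collapse map -/
  map : C(↥{z : c.W | g z < cutLevel n (k + 1)}, OnePoint (EuclideanSpace ℝ (Fin k)))
  /-- the open set on which it is the collapse of the coordinate -/
  V : Set ↥{z : c.W | g z < cutLevel n (k + 1)}
  isOpen_V : IsOpen V
  P_subset_V : T.P ⊆ V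
  eq_on_V : ∀ z : ↥T.N, (z : ↥{z : c.W | g z < cutLevel n (k + 1)}) ∈ V → map z = ballCollapseFun (T.K z)
  apply_eq_iff : ∀ z, map z = ↑(0 : EuclideanSpace ℝ (Fin k)) ↔ z ∈ T.P
  mapsTo_m : MapsTo T.m (closedBall 0 T.r) T.N
  K_m : ∀ (v : EuclideanSpace ℝ (Fin k)) (hv : v ∈ closedBall 0 T.r), T.K ⟨T.m v, mapsTo_m hv⟩ = v
  coe_m_zero : ((T.m 0 : ↥{z : c.W | g z < cutLevel n (k + 1)}) : c.W) = p
  disc_subset : T.disc ⊆ {u | (u : c.W) ∈ stableSet (𝓡∂ (n + 1)) ξ p}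
  disc_mem_nhdsWithin : T.disc ∈ 𝓝[{u | (u : c.W) ∈ stableSet (𝓡∂ (n + 1)) ξ p}] (T.m 0)
  eq_centre : ∀ u : ↥{z : c.W | g z < cutLevel n (k + 1)},
    (u : c.W) ∈ stableSet (𝓡∂ (n + 1)) ξ p → u ∈ T.P → u = T.m 0
  not_mem_P_of_apply_le : ∀ u : ↥{z : c.W | g z < cutLevel n (k + 1)}, g u ≤ cutLevel n k → u ∉ T.P
  not_mem_P_of_mem_stableSet : ∀ p' : c.W, g p' = g p → p' ≠ p →
    ∀ u : ↥{z : c.W | g z < cutLevel n (k + 1)}, (u : c.W) ∈ stableSet (𝓡∂ (n + 1)) ξ p' → u ∉ T.P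

namespace DetectionDatum

variable {c : Cobordism n M N} {g : c.W → ℝ} {ξ : Π x : c.W, TangentSpace (𝓡∂ (n + 1)) x} {k : ℕ} {p : c.W}

/-- The stable set `D_L(p)` of `p`, read in `U` (reducible). [cite: MilnorHCobordism1965, Def. 3.9 (PDF p. 16)] -/
abbrev stable (_Δ : DetectionDatum c g ξ k p) : Set ↥{z : c.W | g z < cutLevel n (k + 1)} :=
  {u | (u : c.W) ∈ stableSet (𝓡∂ (n + 1)) ξ p}

end DetectionDatum

namespace HandleNormalDatum

variable {c : Cobordism n M N} {g : c.W → ℝ} {k : ℕ}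

/-- **A collapse map of the normal datum of a critical point of index `k`** (on
`U = {g < cutLevel n (k + 1)}`): a continuous `γ : U → ℝᵏ ∪ {∞}` which is the collapse of the unit
ball composed with the normal coordinate on an open `V ⊇ D_R(p) ∩ U`, and takes the value `↑0`
exactly on `D_R(p) ∩ U` (the output of `TransverseDiscDatum.exists_collapse`).
[cite: ThomCMH1954, Ch. II] [cite: MilnorHCobordism1965, proof of Lemma 6.3 (PDF p. 37)] -/
structure HandleCollapse (D : HandleNormalDatum c g k) (hk : k ≤ n) where
  /-- the collapse map -/
  map : C(↥D.U, OnePoint (EuclideanSpace ℝ (Fin k)))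
  /-- the open set on which it is the collapse of the coordinate -/
  V : Set ↥D.U
  isOpen_V : IsOpen V
  P_subset_V : (D.datum hk).P ⊆ V
  eq_on_V : ∀ z : ↥(D.datum hk).N, (z : ↥D.U) ∈ V → map z = ballCollapseFun ((D.datum hk).K z)
  apply_eq_iff : ∀ z, map z = ↑(0 : EuclideanSpace ℝ (Fin k)) ↔ z ∈ (D.datum hk).P

/-- **Collapse maps exist** (`U` is metrisable, hence normal). [cite: ThomCMH1954, Ch. II] -/
theorem nonempty_handleCollapse (D : HandleNormalDatum c g k) (hk : k ≤ n) : Nonempty (D.HandleCollapse hk) := by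
  haveI : TopologicalSpace.MetrizableSpace c.W := TopologicalSpace.metrizableSpace_of_t3_secondCountable _
  obtain ⟨γ, V, hV, hPV, -, hγV, hγP⟩ := (D.datum hk).exists_collapse
  exact ⟨⟨γ, V, hV, hPV, hγV, hγP⟩⟩

/-- **The right-hand disc data are detection data** (`k ≤ n`, `g` nice): the datum of
`MorseHandleNormalDatum.lean` with a collapse map of it. [cite: MilnorHCobordism1965, Def. 3.9 (PDF p. 16), Lemma 6.3, Lemma 7.2] -/
def detectionDatum (D : HandleNormalDatum c g k) (hk : k ≤ n) (hg : c.IsNiceMorseFunction g)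
    (C : D.HandleCollapse hk) : DetectionDatum c g (⇑D.ξ) k D.p where
  T := D.datum hk
  map := C.map
  V := C.V
  isOpen_V := C.isOpen_V
  P_subset_V := C.P_subset_V
  eq_on_V := C.eq_on_V
  apply_eq_iff := C.apply_eq_iff
  mapsTo_m := D.mapsTo_m hk
  K_m := D.K_m hk
  coe_m_zero := D.coe_datum_m_zero hk
  disc_subset := D.disc_subset_stable hk
  disc_mem_nhdsWithin := D.disc_mem_nhdsWithin_stable hk
  eq_centre := fun _ hus huP => D.eq_centre_of_mem_stable_of_mem_P hk hus huP
  not_mem_P_of_apply_le := fun _ hu => D.not_mem_P_of_apply_le hk hg hu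
  not_mem_P_of_mem_stableSet := fun _ hlev hne _ hu => D.not_mem_P_of_mem_stableSet_of_ne hk hlev hne hu

/-- **Detection data exist at every critical point of index `k ≤ n`** of a nice Morse function
with a smooth gradient-like field. [cite: MilnorHCobordism1965, Def. 3.9 (PDF p. 16), Lemma 6.3, Lemma 7.2] -/
theorem nonempty_detectionDatum (hg : c.IsNiceMorseFunction g)
    (ξ : Cₛ^∞⟮𝓡∂ (n + 1); EuclideanSpace ℝ (Fin (n + 1)), (TangentSpace (𝓡∂ (n + 1)) : c.W → Type)⟯)
    (hξ : IsGradientLike (𝓡∂ (n + 1)) g ξ) (hk : k ≤ n) {p : c.W}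
    (hp : p ∈ criticalSetOfIndex (𝓡∂ (n + 1)) g k) : Nonempty (DetectionDatum c g (⇑ξ) k p) := by
  obtain ⟨D, hDξ, hDp⟩ := hg.exists_handleNormalDatum ξ hξ hk hp
  obtain ⟨C⟩ := D.nonempty_handleCollapse hk
  subst hDξ; subst hDp
  exact ⟨D.detectionDatum hk hg C⟩

end HandleNormalDatum

/-! ### The main theorem: the collapse maps detect `H_k(U; F)` -/

set_option maxHeartbeats 400000 in
/-- **`H_k(U; F)` is finite-dimensional** for the handlebody `U = {g < cutLevel n (k + 1)}` of a
nice Morse function on a closed manifold (`1 ≤ k ≤ n + 1`): it embeds into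
`H_k(W_k, W_{k-1}; F)`, which has the finite basis of left-hand discs (Milnor 1965, Cor. 3.15).
[cite: MilnorHCobordism1965, Cor. 3.15 (PDF p. 19)] [cite: Milnor1963, Thm. 3.1] -/
theorem IsNiceMorseFunction.finite_singularHomology_sublevel_lt (F : Type) [Field F]
    {X : Type} [TopologicalSpace X] [T2Space X] [SecondCountableTopology X] [CompactSpace X]
    [ChartedSpace (EuclideanSpace ℝ (Fin (n + 1))) X] [IsManifold (𝓡 (n + 1)) ∞ X]
    {g : (Cobordism.ofClosed n X).W → ℝ} (hg : (Cobordism.ofClosed n X).IsNiceMorseFunction g)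
    (ξ : Cₛ^∞⟮𝓡∂ (n + 1); EuclideanSpace ℝ (Fin (n + 1)),
      (TangentSpace (𝓡∂ (n + 1)) : (Cobordism.ofClosed n X).W → Type)⟯)
    (hξ : IsGradientLike (𝓡∂ (n + 1)) g ξ) {k : ℕ} (hk1 : 1 ≤ k) (hkn : k ≤ n + 1) :
    Module.Finite F (singularHomology F F ↥{z : (Cobordism.ofClosed n X).W | g z < cutLevel n (k + 1)} k) := by
  classical
  -- ### notation and levels
  obtain ⟨j, rfl⟩ : ∃ j, k = j + 1 := ⟨k - 1, by omega⟩
  have hgM : (Cobordism.ofClosed n X).IsMorseFunction g := hg.isMorseFunction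
  have hgs : ContMDiff (𝓡∂ (n + 1)) 𝓘(ℝ, ℝ) ∞ g := hgM.isMorse.contMDiff
  have hgc : Continuous g := hgs.continuous
  have hgd : MDifferentiable (𝓡∂ (n + 1)) 𝓘(ℝ, ℝ) g := hgs.mdifferentiable (by simp)
  have ha0 : 0 < (cutLevel n (j + 1)) := (cutLevel_zero n).symm.trans_lt (cutLevel_strictMono n (Nat.succ_pos j))
  have hab : (cutLevel n (j + 1)) < (cutLevel n (j + 1 + 1)) := cutLevel_strictMono n (Nat.lt_succ_self _)
  have hb1 : (cutLevel n (j + 1 + 1)) ≤ 1 := (cutLevel_mono n (show j + 1 + 1 ≤ n + 2 by omega)).trans_eq (cutLevel_eq_one n)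
  have hνa : (cutLevel n (j + 1)) < niceLevel n (j + 1) := cutLevel_lt_niceLevel n (j + 1)
  have hνb : niceLevel n (j + 1) < (cutLevel n (j + 1 + 1)) := niceLevel_lt_cutLevel_succ n (j + 1)
  have hreg : ∀ z ∈ criticalSet (𝓡∂ (n + 1)) g, g z ≠ (cutLevel n (j + 1)) ∧ g z ≠ (cutLevel n (j + 1 + 1)) := fun z hz =>
    ⟨hg.apply_ne_cutLevel hz (j + 1), hg.apply_ne_cutLevel hz (j + 1 + 1)⟩
  have hWaU : {z : (Cobordism.ofClosed n X).W | g z ≤ cutLevel n (j + 1)} ⊆ ({z : (Cobordism.ofClosed n X).W | g z < cutLevel n (j + 1 + 1)}) := fun z hz => show g z < (cutLevel n (j + 1 + 1)) from lt_of_le_of_lt hz hab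
  have hUWb : ({z : (Cobordism.ofClosed n X).W | g z < cutLevel n (j + 1 + 1)}) ⊆ {z : (Cobordism.ofClosed n X).W | g z ≤ cutLevel n (j + 1 + 1)} := fun z hz => show g z ≤ (cutLevel n (j + 1 + 1)) from le_of_lt hz
  -- ### `g` read on `X`
  let f : X → ℝ := fun y => g (HalfSpaceCharted.of y)
  have hfg : f ∘ ⇑HalfSpaceCharted.of.symm = g := rfl
  have hfM : IsMorse (𝓡 (n + 1)) f := HalfSpaceCharted.isMorse_iff.1 (hfg ▸ hgM.isMorse)
  have hfs : ContMDiff (𝓡 (n + 1)) 𝓘(ℝ, ℝ) ∞ f := hfM.contMDiff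
  have hcritf : ∀ y, IsMCriticalPt (𝓡 (n + 1)) f y → HalfSpaceCharted.of y ∈ criticalSet (𝓡∂ (n + 1)) g :=
    fun y hy => (HalfSpaceCharted.isMCriticalPt_iff' (f := f) (q := HalfSpaceCharted.of y)).2 hy
  have hindf : ∀ y, IsMCriticalPt (𝓡 (n + 1)) f y →
      morseIndex (𝓡 (n + 1)) f y = morseIndex (𝓡∂ (n + 1)) g (HalfSpaceCharted.of y) := fun y hy => by
    rw [← hfg]
    exact (HalfSpaceCharted.morseIndex_eq' ((hfs _).of_le (by norm_cast)) hy).symm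
  -- ### (1) `H_{j+1}(W_a; F) = 0`
  have hidx_ne : ∀ y ∈ criticalSet (𝓡 (n + 1)) f, f y ≤ (cutLevel n (j + 1)) → morseIndex (𝓡 (n + 1)) f y ≠ j + 1 := by
    intro y hy hya hidx
    rw [hindf y hy] at hidx
    have hval : g (HalfSpaceCharted.of y) = niceLevel n (j + 1) :=
      (hg.apply_eq (hcritf y hy)).trans (congrArg (niceLevel n) hidx)
    have hya' : g (HalfSpaceCharted.of y) ≤ (cutLevel n (j + 1)) := hya
    linarith
  have hWa0 : IsZero (singularHomology F F ↥{z : (Cobordism.ofClosed n X).W | g z ≤ cutLevel n (j + 1)} (j + 1)) :=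
    IsMorse.isZero_singularHomology_sublevel F F hfM (a := cutLevel n (j + 1))
      (fun y hy => (hreg _ (hcritf y hy)).1) ((isClosed_le hfs.continuous continuous_const).isCompact) hidx_ne
  -- ### (2) `j⁎ : H_{j+1}(({z : (Cobordism.ofClosed n X).W | g z < cutLevel n (j + 1 + 1)})) → H_{j+1}(({z : (Cobordism.ofClosed n X).W | g z < cutLevel n (j + 1 + 1)}), W_a)` is injective
  let U'' : Set ↥({z : (Cobordism.ofClosed n X).W | g z < cutLevel n (j + 1 + 1)}) := Subtype.val ⁻¹' {z : (Cobordism.ofClosed n X).W | g z ≤ cutLevel n (j + 1)}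
  have hU''0 : IsZero (singularHomology F F ↥U'' (j + 1)) :=
    hWa0.of_iso (singularHomology.mapIso F F (preimageValHomeomorphOfSubset hWaU) (j + 1))
  have hjinj := injective_ofAbsolute_of_isZero F F U'' (j + 1) hU''0
  -- ### (3) the inclusion `ι : ({z : (Cobordism.ofClosed n X).W | g z < cutLevel n (j + 1 + 1)}) → W_b` is injective on `H_{j+1}` ((cutLevel n (j + 1)) homotopy equivalence)
  let ι : C(↥({z : (Cobordism.ofClosed n X).W | g z < cutLevel n (j + 1 + 1)}), ↥{z : (Cobordism.ofClosed n X).W | g z ≤ cutLevel n (j + 1 + 1)}) := ⟨fun u => ⟨u.1, hUWb u.2⟩, continuous_subtype_val.subtype_mk _⟩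
  have hregb : ∀ y, f y = (cutLevel n (j + 1 + 1)) → mfderiv (𝓡 (n + 1)) 𝓘(ℝ, ℝ) f y ≠ 0 := by
    intro y hy hd
    exact (hreg _ (hcritf y hd)).2 hy
  have hιinj : ∀ i : ℕ, Function.Injective (singularHomology.map F F ι i) := fun i =>
    (bijective_map_inclusion_sublevel_lt F F hfs hregb i).1
  -- ### (4) `ι⁎ : H_{j+1}(({z : (Cobordism.ofClosed n X).W | g z < cutLevel n (j + 1 + 1)}), W_a) → H_{j+1}(W_b, W_a)` is injective
  let Wa' : Set ↥{z : (Cobordism.ofClosed n X).W | g z ≤ cutLevel n (j + 1 + 1)} := Subtype.val ⁻¹' {z : (Cobordism.ofClosed n X).W | g z ≤ cutLevel n (j + 1)}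
  have hιA : MapsTo ι U'' Wa' := fun u hu => hu
  have hWa'0 : IsZero (singularHomology F F ↥Wa' (j + 1)) :=
    hWa0.of_iso (singularHomology.mapIso F F (preimageValHomeomorphOfSubset (hWaU.trans hUWb)) (j + 1))
  have hres : Function.Injective (singularHomology.map F F (subsetRestrict ι hιA) j) := by
    let er : ↥U'' ≃ₜ ↥Wa' :=
      (preimageValHomeomorphOfSubset hWaU).trans (preimageValHomeomorphOfSubset (hWaU.trans hUWb)).symm
    have : subsetRestrict ι hιA = (er : C(↥U'', ↥Wa')) := by ext u; rfl
    rw [this]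
    exact (singularHomology.mapIso F F er j).toLinearEquiv.injective
  have hιrel := relativeSingularHomology.injective_map_of_injective F F ι hιA j (hιinj (j + 1)) hres hWa'0
  -- ### (5) the basis of `H_{j+1}(W_b, W_a)` by left-hand discs
  have hcrit : ∀ z ∈ criticalSet (𝓡∂ (n + 1)) g, g z ∈ Icc (cutLevel n (j + 1)) (cutLevel n (j + 1 + 1)) →
      g z = niceLevel n (j + 1) ∧ morseIndex (𝓡∂ (n + 1)) g z = j + 1 := by
    intro z hz hzI
    have hzI' : g z ∈ Ioo (cutLevel n (j + 1)) (cutLevel n (j + 1 + 1)) :=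
      ⟨lt_of_le_of_ne hzI.1 (hreg z hz).1.symm, lt_of_le_of_ne hzI.2 (hreg z hz).2⟩
    have hidx : morseIndex (𝓡∂ (n + 1)) g z = j + 1 := (hg.morseIndex_eq_iff_apply_mem_Ioo hz).2 hzI'
    exact ⟨by rw [hg.apply_eq hz, hidx], hidx⟩
  obtain ⟨e, he⟩ := Cobordism.exists_basis_leftHandDiscs_slab F hgM ξ hξ ha0.le hνa hνb hb1 hcrit
  let P : Set (Cobordism.ofClosed n X).W := criticalSet (𝓡∂ (n + 1)) g ∩ g ⁻¹' Icc (cutLevel n (j + 1)) (cutLevel n (j + 1 + 1))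
  have hPk : P = criticalSetOfIndex (𝓡∂ (n + 1)) g (j + 1) := by
    rw [← hg.criticalSet_inter_preimage_Ioo (j + 1)]
    ext z
    constructor
    · rintro ⟨hz, hzI⟩
      exact ⟨hz, lt_of_le_of_ne hzI.1 (hreg z hz).1.symm, lt_of_le_of_ne hzI.2 (hreg z hz).2⟩
    · rintro ⟨hz, hzI⟩
      exact ⟨hz, hzI.1.le, hzI.2.le⟩
  have hPfin : P.Finite :=
    (IsMorse.finite_criticalSet_holds (I := 𝓡∂ (n + 1)) (M := (Cobordism.ofClosed n X).W) hgM.isMorse).subset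
      inter_subset_left
  haveI : Fintype ↥P := hPfin.fintype
  -- the slab-to-sublevel isomorphism and the transported basis `e'`
  let σ : C(↥(g ⁻¹' Icc (cutLevel n (j + 1)) (cutLevel n (j + 1 + 1))), ↥{z : (Cobordism.ofClosed n X).W | g z ≤ cutLevel n (j + 1 + 1)}) := ⟨fun z => ⟨z.1, z.2.2⟩, by fun_prop⟩
  have hσA : MapsTo σ {z : ↥(g ⁻¹' Icc (cutLevel n (j + 1)) (cutLevel n (j + 1 + 1))) | g z.1 = (cutLevel n (j + 1))} Wa' := fun _ hz => le_of_eq hz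
  haveI hσiso := hgM.isIso_map_slab_sublevel_coeff F F ha0 hab hreg (j + 1)
  let σ' := relativeSingularHomology.map F F σ hσA (j + 1)
  haveI : IsIso σ' := hσiso
  let e' := e.map (asIso σ').toLinearEquiv
  haveI : Module.Finite F (relativeSingularHomology F F ↥{z : (Cobordism.ofClosed n X).W | g z ≤ cutLevel n (j + 1 + 1)} Wa' (j + 1)) :=
    Module.Finite.of_basis e'
  exact Module.Finite.of_injective
    ((relativeSingularHomology.map F F ι hιA (j + 1)).hom ∘ₗ
      (relativeSingularHomology.ofAbsolute F F ↥({z : (Cobordism.ofClosed n X).W | g z < cutLevel n (j + 1 + 1)}) U'' (j + 1)).hom)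
    (hιrel.comp hjinj)

set_option maxHeartbeats 800000 in
/-- **The collapse maps of the right-hand discs detect `H_k` of the handlebody** (Milnor 1965,
Cor. 3.15 / Thm. 7.6 with Lemmas 6.3, 7.2, homological form; Thom 1954, Ch. II).  Let `X` be a
closed `(n+1)`-manifold, `g` a nice Morse function on `(X; ∅, ∅)`, `ξ` a smooth gradient-like
field, `1 ≤ k ≤ n`, `U = {g < cutLevel n (k + 1)}`; for every critical point `p` of index `k` fix
the normal datum of `D_R(p)` built from `ξ` (`HandleNormalDatum`) and a collapse `γ_p` of it.
Then for every field `F` and every non-zero `x ∈ H_k(U; F)` there is a critical point `p` of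
index `k` with `(γ_p)⁎ x ≠ 0` in `H_k(ℝᵏ ∪ {∞}; F)`.  Proof: `x ↦ H_k(U, W_{k-1})` injectively
(`H_k(W_{k-1}) = 0`), then into `H_k(W_k, W_{k-1})` injectively (`U ↪ W_k` is a homotopy
equivalence), where it is a combination `Σ r_p [D_L(p)]` of the disc classes with some
`r_{p₀} ≠ 0`; localising at `D_R(p₀)` kills the `[D_L(p)]`, `p ≠ p₀`, and `γ_{p₀}` is injective
on the local homology of `D_L(p₀)` at `p₀`.
[cite: MilnorHCobordism1965, Cor. 3.15 (PDF p. 19), Lemma 6.3 (PDF p. 37), Lemma 7.2, Thm. 7.6 (PDF pp. 46–50)] [cite: ThomCMH1954, Ch. II] -/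
theorem IsNiceMorseFunction.exists_map_collapse_ne_zero (F : Type) [Field F]
    {X : Type} [TopologicalSpace X] [T2Space X] [SecondCountableTopology X] [CompactSpace X]
    [ChartedSpace (EuclideanSpace ℝ (Fin (n + 1))) X] [IsManifold (𝓡 (n + 1)) ∞ X]
    {g : (Cobordism.ofClosed n X).W → ℝ} (hg : (Cobordism.ofClosed n X).IsNiceMorseFunction g)
    (ξ : Cₛ^∞⟮𝓡∂ (n + 1); EuclideanSpace ℝ (Fin (n + 1)),
      (TangentSpace (𝓡∂ (n + 1)) : (Cobordism.ofClosed n X).W → Type)⟯)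
    (hξ : IsGradientLike (𝓡∂ (n + 1)) g ξ) {k : ℕ} (hk1 : 1 ≤ k) (hkn : k ≤ n + 1)
    (Δ : ∀ p : ↥(criticalSetOfIndex (𝓡∂ (n + 1)) g k), DetectionDatum (Cobordism.ofClosed n X) g (⇑ξ) k p)
    (x : singularHomology F F ↥{z : (Cobordism.ofClosed n X).W | g z < cutLevel n (k + 1)} k)
    (hx : x ≠ 0) :
    ∃ p, singularHomology.map F F (Δ p).map k x ≠ 0 := by
  classical
  -- ### notation and levels
  obtain ⟨j, rfl⟩ : ∃ j, k = j + 1 := ⟨k - 1, by omega⟩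
  have hgM : (Cobordism.ofClosed n X).IsMorseFunction g := hg.isMorseFunction
  have hgs : ContMDiff (𝓡∂ (n + 1)) 𝓘(ℝ, ℝ) ∞ g := hgM.isMorse.contMDiff
  have hgc : Continuous g := hgs.continuous
  have hgd : MDifferentiable (𝓡∂ (n + 1)) 𝓘(ℝ, ℝ) g := hgs.mdifferentiable (by simp)
  have ha0 : 0 < (cutLevel n (j + 1)) := (cutLevel_zero n).symm.trans_lt (cutLevel_strictMono n (Nat.succ_pos j))
  have hab : (cutLevel n (j + 1)) < (cutLevel n (j + 1 + 1)) := cutLevel_strictMono n (Nat.lt_succ_self _)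
  have hb1 : (cutLevel n (j + 1 + 1)) ≤ 1 := (cutLevel_mono n (show j + 1 + 1 ≤ n + 2 by omega)).trans_eq (cutLevel_eq_one n)
  have hνa : (cutLevel n (j + 1)) < niceLevel n (j + 1) := cutLevel_lt_niceLevel n (j + 1)
  have hνb : niceLevel n (j + 1) < (cutLevel n (j + 1 + 1)) := niceLevel_lt_cutLevel_succ n (j + 1)
  have hreg : ∀ z ∈ criticalSet (𝓡∂ (n + 1)) g, g z ≠ (cutLevel n (j + 1)) ∧ g z ≠ (cutLevel n (j + 1 + 1)) := fun z hz =>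
    ⟨hg.apply_ne_cutLevel hz (j + 1), hg.apply_ne_cutLevel hz (j + 1 + 1)⟩
  have hWaU : {z : (Cobordism.ofClosed n X).W | g z ≤ cutLevel n (j + 1)} ⊆ ({z : (Cobordism.ofClosed n X).W | g z < cutLevel n (j + 1 + 1)}) := fun z hz => show g z < (cutLevel n (j + 1 + 1)) from lt_of_le_of_lt hz hab
  have hUWb : ({z : (Cobordism.ofClosed n X).W | g z < cutLevel n (j + 1 + 1)}) ⊆ {z : (Cobordism.ofClosed n X).W | g z ≤ cutLevel n (j + 1 + 1)} := fun z hz => show g z ≤ (cutLevel n (j + 1 + 1)) from le_of_lt hz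
  -- ### `g` read on `X`
  let f : X → ℝ := fun y => g (HalfSpaceCharted.of y)
  have hfg : f ∘ ⇑HalfSpaceCharted.of.symm = g := rfl
  have hfM : IsMorse (𝓡 (n + 1)) f := HalfSpaceCharted.isMorse_iff.1 (hfg ▸ hgM.isMorse)
  have hfs : ContMDiff (𝓡 (n + 1)) 𝓘(ℝ, ℝ) ∞ f := hfM.contMDiff
  have hcritf : ∀ y, IsMCriticalPt (𝓡 (n + 1)) f y → HalfSpaceCharted.of y ∈ criticalSet (𝓡∂ (n + 1)) g :=
    fun y hy => (HalfSpaceCharted.isMCriticalPt_iff' (f := f) (q := HalfSpaceCharted.of y)).2 hy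
  have hindf : ∀ y, IsMCriticalPt (𝓡 (n + 1)) f y →
      morseIndex (𝓡 (n + 1)) f y = morseIndex (𝓡∂ (n + 1)) g (HalfSpaceCharted.of y) := fun y hy => by
    rw [← hfg]
    exact (HalfSpaceCharted.morseIndex_eq' ((hfs _).of_le (by norm_cast)) hy).symm
  -- ### (1) `H_{j+1}(W_a; F) = 0`
  have hidx_ne : ∀ y ∈ criticalSet (𝓡 (n + 1)) f, f y ≤ (cutLevel n (j + 1)) → morseIndex (𝓡 (n + 1)) f y ≠ j + 1 := by
    intro y hy hya hidx
    rw [hindf y hy] at hidx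
    have hval : g (HalfSpaceCharted.of y) = niceLevel n (j + 1) :=
      (hg.apply_eq (hcritf y hy)).trans (congrArg (niceLevel n) hidx)
    have hya' : g (HalfSpaceCharted.of y) ≤ (cutLevel n (j + 1)) := hya
    linarith
  have hWa0 : IsZero (singularHomology F F ↥{z : (Cobordism.ofClosed n X).W | g z ≤ cutLevel n (j + 1)} (j + 1)) :=
    IsMorse.isZero_singularHomology_sublevel F F hfM (a := cutLevel n (j + 1))
      (fun y hy => (hreg _ (hcritf y hy)).1) ((isClosed_le hfs.continuous continuous_const).isCompact) hidx_ne
  -- ### (2) `j⁎ : H_{j+1}(({z : (Cobordism.ofClosed n X).W | g z < cutLevel n (j + 1 + 1)})) → H_{j+1}(({z : (Cobordism.ofClosed n X).W | g z < cutLevel n (j + 1 + 1)}), W_a)` is injective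
  let U'' : Set ↥({z : (Cobordism.ofClosed n X).W | g z < cutLevel n (j + 1 + 1)}) := Subtype.val ⁻¹' {z : (Cobordism.ofClosed n X).W | g z ≤ cutLevel n (j + 1)}
  have hU''0 : IsZero (singularHomology F F ↥U'' (j + 1)) :=
    hWa0.of_iso (singularHomology.mapIso F F (preimageValHomeomorphOfSubset hWaU) (j + 1))
  have hjinj := injective_ofAbsolute_of_isZero F F U'' (j + 1) hU''0
  -- ### (3) the inclusion `ι : ({z : (Cobordism.ofClosed n X).W | g z < cutLevel n (j + 1 + 1)}) → W_b` is injective on `H_{j+1}` ((cutLevel n (j + 1)) homotopy equivalence)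
  let ι : C(↥({z : (Cobordism.ofClosed n X).W | g z < cutLevel n (j + 1 + 1)}), ↥{z : (Cobordism.ofClosed n X).W | g z ≤ cutLevel n (j + 1 + 1)}) := ⟨fun u => ⟨u.1, hUWb u.2⟩, continuous_subtype_val.subtype_mk _⟩
  have hregb : ∀ y, f y = (cutLevel n (j + 1 + 1)) → mfderiv (𝓡 (n + 1)) 𝓘(ℝ, ℝ) f y ≠ 0 := by
    intro y hy hd
    exact (hreg _ (hcritf y hd)).2 hy
  have hιinj : ∀ i : ℕ, Function.Injective (singularHomology.map F F ι i) := fun i =>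
    (bijective_map_inclusion_sublevel_lt F F hfs hregb i).1
  -- ### (4) `ι⁎ : H_{j+1}(({z : (Cobordism.ofClosed n X).W | g z < cutLevel n (j + 1 + 1)}), W_a) → H_{j+1}(W_b, W_a)` is injective
  let Wa' : Set ↥{z : (Cobordism.ofClosed n X).W | g z ≤ cutLevel n (j + 1 + 1)} := Subtype.val ⁻¹' {z : (Cobordism.ofClosed n X).W | g z ≤ cutLevel n (j + 1)}
  have hιA : MapsTo ι U'' Wa' := fun u hu => hu
  have hWa'0 : IsZero (singularHomology F F ↥Wa' (j + 1)) :=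
    hWa0.of_iso (singularHomology.mapIso F F (preimageValHomeomorphOfSubset (hWaU.trans hUWb)) (j + 1))
  have hres : Function.Injective (singularHomology.map F F (subsetRestrict ι hιA) j) := by
    let er : ↥U'' ≃ₜ ↥Wa' :=
      (preimageValHomeomorphOfSubset hWaU).trans (preimageValHomeomorphOfSubset (hWaU.trans hUWb)).symm
    have : subsetRestrict ι hιA = (er : C(↥U'', ↥Wa')) := by ext u; rfl
    rw [this]
    exact (singularHomology.mapIso F F er j).toLinearEquiv.injective
  have hιrel := relativeSingularHomology.injective_map_of_injective F F ι hιA j (hιinj (j + 1)) hres hWa'0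
  -- ### (5) the basis of `H_{j+1}(W_b, W_a)` by left-hand discs
  have hcrit : ∀ z ∈ criticalSet (𝓡∂ (n + 1)) g, g z ∈ Icc (cutLevel n (j + 1)) (cutLevel n (j + 1 + 1)) →
      g z = niceLevel n (j + 1) ∧ morseIndex (𝓡∂ (n + 1)) g z = j + 1 := by
    intro z hz hzI
    have hzI' : g z ∈ Ioo (cutLevel n (j + 1)) (cutLevel n (j + 1 + 1)) :=
      ⟨lt_of_le_of_ne hzI.1 (hreg z hz).1.symm, lt_of_le_of_ne hzI.2 (hreg z hz).2⟩
    have hidx : morseIndex (𝓡∂ (n + 1)) g z = j + 1 := (hg.morseIndex_eq_iff_apply_mem_Ioo hz).2 hzI'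
    exact ⟨by rw [hg.apply_eq hz, hidx], hidx⟩
  obtain ⟨e, he⟩ := Cobordism.exists_basis_leftHandDiscs_slab F hgM ξ hξ ha0.le hνa hνb hb1 hcrit
  let P : Set (Cobordism.ofClosed n X).W := criticalSet (𝓡∂ (n + 1)) g ∩ g ⁻¹' Icc (cutLevel n (j + 1)) (cutLevel n (j + 1 + 1))
  have hPk : P = criticalSetOfIndex (𝓡∂ (n + 1)) g (j + 1) := by
    rw [← hg.criticalSet_inter_preimage_Ioo (j + 1)]
    ext z
    constructor
    · rintro ⟨hz, hzI⟩
      exact ⟨hz, lt_of_le_of_ne hzI.1 (hreg z hz).1.symm, lt_of_le_of_ne hzI.2 (hreg z hz).2⟩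
    · rintro ⟨hz, hzI⟩
      exact ⟨hz, hzI.1.le, hzI.2.le⟩
  have hPfin : P.Finite :=
    (IsMorse.finite_criticalSet_holds (I := 𝓡∂ (n + 1)) (M := (Cobordism.ofClosed n X).W) hgM.isMorse).subset
      inter_subset_left
  haveI : Fintype ↥P := hPfin.fintype
  -- the slab-to-sublevel isomorphism and the transported basis `e'`
  let σ : C(↥(g ⁻¹' Icc (cutLevel n (j + 1)) (cutLevel n (j + 1 + 1))), ↥{z : (Cobordism.ofClosed n X).W | g z ≤ cutLevel n (j + 1 + 1)}) := ⟨fun z => ⟨z.1, z.2.2⟩, by fun_prop⟩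
  have hσA : MapsTo σ {z : ↥(g ⁻¹' Icc (cutLevel n (j + 1)) (cutLevel n (j + 1 + 1))) | g z.1 = (cutLevel n (j + 1))} Wa' := fun _ hz => le_of_eq hz
  haveI hσiso := hgM.isIso_map_slab_sublevel_coeff F F ha0 hab hreg (j + 1)
  let σ' := relativeSingularHomology.map F F σ hσA (j + 1)
  haveI : IsIso σ' := hσiso
  let e' := e.map (asIso σ').toLinearEquiv
  -- ### (6) the disc classes in `H_{j+1}(({z : (Cobordism.ofClosed n X).W | g z < cutLevel n (j + 1 + 1)}), W_a)`
  choose hDL1 hDL0 γ hγ using he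
  have hDU : ∀ p : ↥P, leftHandDisc (𝓡∂ (n + 1)) g ξ p (cutLevel n (j + 1)) ⊆ ({z : (Cobordism.ofClosed n X).W | g z < cutLevel n (j + 1 + 1)}) := fun p w hw =>
    show g w < (cutLevel n (j + 1 + 1)) from (hξ.apply_le_of_mem_stableSet hgd hw.1).trans_lt ((hcrit p p.2.1 p.2.2).1 ▸ hνb)
  let inclDU : ∀ p : ↥P, C(↥(leftHandDisc (𝓡∂ (n + 1)) g ξ p (cutLevel n (j + 1))), ↥({z : (Cobordism.ofClosed n X).W | g z < cutLevel n (j + 1 + 1)})) := fun p =>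
    ⟨fun w => ⟨w.1, hDU p w.2⟩, continuous_subtype_val.subtype_mk _⟩
  have hinclA : ∀ p : ↥P, MapsTo (inclDU p) (Subtype.val ⁻¹' leftHandSphere (𝓡∂ (n + 1)) g ξ p (cutLevel n (j + 1))) U'' :=
    fun p w hw => show g w.1 ≤ (cutLevel n (j + 1)) from le_of_eq hw.2
  let d : ∀ p : ↥P, relativeSingularHomology F F ↥({z : (Cobordism.ofClosed n X).W | g z < cutLevel n (j + 1 + 1)}) U'' (j + 1) := fun p =>
    relativeSingularHomology.map F F (inclDU p) (hinclA p) (j + 1) (γ p)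
  let ιrel := relativeSingularHomology.map F F ι hιA (j + 1)
  have hιd : ∀ p : ↥P, ιrel (d p) = e' p := by
    intro p
    have h1 : ι.comp (inclDU p) = σ.comp ⟨Set.inclusion (hDL1 p), continuous_inclusion (hDL1 p)⟩ := by
      ext w; rfl
    change (relativeSingularHomology.map F F (inclDU p) (hinclA p) (j + 1) ≫ ιrel) (γ p) = _
    rw [← relativeSingularHomology.map_comp,
      relativeSingularHomology.map_congr F F h1 _ ((hσA).comp (hDL0 p)) (j + 1),
      relativeSingularHomology.map_comp, ModuleCat.comp_apply]
    change σ' ((relativeSingularHomology.map F F _ (hDL0 p) (j + 1)).hom (γ p)) = e' p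
    rw [hγ p]
    rfl
  -- ### (7) the class of `x` in `H_{j+1}(W_b, W_a)` and its expansion
  let jmap := relativeSingularHomology.ofAbsolute F F ↥({z : (Cobordism.ofClosed n X).W | g z < cutLevel n (j + 1 + 1)}) U'' (j + 1)
  let y := jmap x
  have hy : y ≠ 0 := fun h => hx (hjinj (by rw [map_zero]; exact h))
  let z := ιrel y
  have hz : z ≠ 0 := fun h => hy (hιrel (by rw [map_zero]; exact h))
  let r : ↥P → F := fun p => e'.repr z p
  obtain ⟨p₀, hp₀⟩ : ∃ p₀, r p₀ ≠ 0 := by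
    by_contra h
    push Not at h
    apply hz
    rw [← e'.sum_repr z]
    exact Finset.sum_eq_zero fun p _ => by rw [show e'.repr z p = 0 from h p, zero_smul]
  have hyd : y = ∑ p, r p • d p := by
    apply hιrel
    calc ιrel y = z := rfl
      _ = ∑ p, r p • e' p := (e'.sum_repr z).symm
      _ = ∑ p, r p • ιrel (d p) := Finset.sum_congr rfl fun p _ => by rw [hιd p]
      _ = ιrel (∑ p, r p • d p) := by
        rw [map_sum]
        exact Finset.sum_congr rfl fun p _ => by rw [map_smul]
  -- ### (8) localisation at `D_R(p₀)`
  have hp₀k : (p₀ : (Cobordism.ofClosed n X).W) ∈ criticalSetOfIndex (𝓡∂ (n + 1)) g (j + 1) := hPk ▸ p₀.2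
  let p₀' : ↥(criticalSetOfIndex (𝓡∂ (n + 1)) g (j + 1)) := ⟨p₀, hp₀k⟩
  have hν₀ : g p₀ = niceLevel n (j + 1) := (hcrit p₀ p₀.2.1 p₀.2.2).1
  have hm0 : (((Δ p₀').T.m 0 : ↥({z : (Cobordism.ofClosed n X).W | g z < cutLevel n (j + 1 + 1)})) : (Cobordism.ofClosed n X).W) = p₀ :=
    (Δ p₀').coe_m_zero
  -- membership in the stable set of the datum
  have hstable : ∀ {w : (Cobordism.ofClosed n X).W} (hwU : w ∈ ({z : (Cobordism.ofClosed n X).W | g z < cutLevel n (j + 1 + 1)})),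
      w ∈ stableSet (𝓡∂ (n + 1)) (⇑ξ) p₀ → (⟨w, hwU⟩ : ↥({z : (Cobordism.ofClosed n X).W | g z < cutLevel n (j + 1 + 1)})) ∈ (Δ p₀').stable :=
    fun _ hw => hw
  have hstable' : ∀ {u : ↥({z : (Cobordism.ofClosed n X).W | g z < cutLevel n (j + 1 + 1)})}, u ∈ (Δ p₀').stable → (u : (Cobordism.ofClosed n X).W) ∈ stableSet (𝓡∂ (n + 1)) (⇑ξ) p₀ :=
    fun hu => hu
  -- the localisation and the collapse on relative homology, as one linear map `Λ`
  have hlam : MapsTo (ContinuousMap.id ↥({z : (Cobordism.ofClosed n X).W | g z < cutLevel n (j + 1 + 1)})) U'' ((Δ p₀').T).Pᶜ :=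
    fun u hu => (Δ p₀').not_mem_P_of_apply_le u hu
  have hgr : MapsTo (Δ p₀').map ((Δ p₀').T).Pᶜ {(↑(0 : EuclideanSpace ℝ (Fin (j + 1))) : OnePoint _)}ᶜ :=
    fun u hu h => hu (((Δ p₀').apply_eq_iff u).1 h)
  let Λ : relativeSingularHomology F F ↥({z : (Cobordism.ofClosed n X).W | g z < cutLevel n (j + 1 + 1)}) U'' (j + 1) →ₗ[F]
      relativeSingularHomology F F (OnePoint (EuclideanSpace ℝ (Fin (j + 1)))) {(↑(0 : EuclideanSpace ℝ (Fin (j + 1))) : OnePoint _)}ᶜ (j + 1) :=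
    (relativeSingularHomology.map F F (Δ p₀').map hgr (j + 1)).hom ∘ₗ
      (relativeSingularHomology.map F F (ContinuousMap.id ↥({z : (Cobordism.ofClosed n X).W | g z < cutLevel n (j + 1 + 1)})) hlam (j + 1)).hom
  -- Claim A: `Λ y` is the class of `(γ_{p₀})⁎ x`
  have hA : Λ y = relativeSingularHomology.ofAbsolute F F _ {(↑(0 : EuclideanSpace ℝ (Fin (j + 1))) : OnePoint _)}ᶜ
      (j + 1) (singularHomology.map F F (Δ p₀').map (j + 1) x) := by
    have h := relativeSingularHomology.ofAbsolute_comp_map F F (X := ↥({z : (Cobordism.ofClosed n X).W | g z < cutLevel n (j + 1 + 1)})) ((Δ p₀').map.comp (ContinuousMap.id ↥({z : (Cobordism.ofClosed n X).W | g z < cutLevel n (j + 1 + 1)})))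
      (hgr.comp hlam) (j + 1)
    rw [relativeSingularHomology.map_comp] at h
    have h' := LinearMap.congr_fun (congrArg ModuleCat.Hom.hom h) x
    simp only [ModuleCat.hom_comp, LinearMap.coe_comp, Function.comp_apply] at h'
    exact h'
  -- Claim B, (i): the discs `D_L(p)`, `p ≠ p₀`, die
  have hkill : ∀ p : ↥P, p ≠ p₀ → Λ (d p) = 0 := by
    intro p hp
    have hne : (p : (Cobordism.ofClosed n X).W) ≠ p₀ := fun h => hp (Subtype.ext h)
    have hlev : g p = g p₀ := by rw [hν₀]; exact (hcrit p p.2.1 p.2.2).1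
    have huniv : MapsTo ((ContinuousMap.id ↥({z : (Cobordism.ofClosed n X).W | g z < cutLevel n (j + 1 + 1)})).comp (inclDU p)) univ ((Δ p₀').T).Pᶜ :=
      fun w _ => (Δ p₀').not_mem_P_of_mem_stableSet p hlev hne _ w.2.1
    have h0 := relativeSingularHomology.map_eq_zero_of_mapsTo_univ F F
      ((ContinuousMap.id ↥({z : (Cobordism.ofClosed n X).W | g z < cutLevel n (j + 1 + 1)})).comp (inclDU p))
      (fun w hw => hlam (hinclA p hw)) huniv (j + 1)
    rw [relativeSingularHomology.map_comp] at h0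
    have h1 : (relativeSingularHomology.map F F (ContinuousMap.id ↥({z : (Cobordism.ofClosed n X).W | g z < cutLevel n (j + 1 + 1)})) hlam (j + 1)).hom (d p) = 0 := by
      have := LinearMap.congr_fun (congrArg ModuleCat.Hom.hom h0) (γ p)
      simpa only [ModuleCat.hom_comp, LinearMap.coe_comp, Function.comp_apply, ModuleCat.hom_zero,
        LinearMap.zero_apply] using this
    show (relativeSingularHomology.map F F (Δ p₀').map hgr (j + 1)).hom
      ((relativeSingularHomology.map F F (ContinuousMap.id ↥({z : (Cobordism.ofClosed n X).W | g z < cutLevel n (j + 1 + 1)})) hlam (j + 1)).hom (d p)) = 0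
    rw [h1, map_zero]
  -- Claim B, (ii): the disc `D_L(p₀)` survives: `Λ (d p₀) ≠ 0`
  have hmain : Λ (d p₀) ≠ 0 := by
    -- the point `p₀` of its left-hand disc
    have hp₀D : (p₀ : (Cobordism.ofClosed n X).W) ∈ leftHandDisc (𝓡∂ (n + 1)) g ξ p₀ (cutLevel n (j + 1)) :=
      ⟨self_mem_stableSet (hξ.apply_eq_zero_of_isMCriticalPt p₀.2.1), show (cutLevel n (j + 1)) ≤ g p₀ by rw [hν₀]; exact hνa.le⟩
    let v₀ : ↥(leftHandDisc (𝓡∂ (n + 1)) g ξ p₀ (cutLevel n (j + 1))) := ⟨p₀, hp₀D⟩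
    have hv₀a : g v₀.1 ≠ (cutLevel n (j + 1)) := by rw [show g v₀.1 = g p₀ from rfl, hν₀]; exact hνa.ne'
    -- the localisation `H(D_L, S_L) → H(D_L | v₀)` is bijective
    have hnoval : ∀ w ∈ criticalSet (𝓡∂ (n + 1)) g, g w ∉ Ico (cutLevel n (j + 1)) (g p₀) := by
      intro w hw hwI
      rw [hν₀, hg.apply_eq hw] at hwI
      have h1 : niceLevel n (morseIndex (𝓡∂ (n + 1)) g w) ≠ (cutLevel n (j + 1)) := by rw [← hg.apply_eq hw]; exact (hreg w hw).1
      have h2 : cutLevel n (j + 1) < niceLevel n (morseIndex (𝓡∂ (n + 1)) g w) := lt_of_le_of_ne hwI.1 h1.symm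
      have h3 : morseIndex (𝓡∂ (n + 1)) g w < j + 1 := (niceLevel_strictMono n).lt_iff_lt.1 hwI.2
      have h4 : niceLevel n (morseIndex (𝓡∂ (n + 1)) g w) < cutLevel n (morseIndex (𝓡∂ (n + 1)) g w + 1) :=
        niceLevel_lt_cutLevel_succ n _
      have h5 : cutLevel n (morseIndex (𝓡∂ (n + 1)) g w + 1) ≤ cutLevel n (j + 1) := cutLevel_mono n (by omega)
      linarith
    have ha0p : (cutLevel n (j + 1)) < g p₀ := by rw [hν₀]; exact hνa
    have hbij := Cobordism.bijective_localisation_leftHandDisc F F hgM ξ hξ ha0.le hp₀k ha0p hnoval v₀ hv₀a (j + 1)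
    -- the collapse read on `D_L(p₀)`, as (cutLevel n (j + 1)) map of pairs `(D_L, D_L ∖ v₀) → (Y, Y ∖ 0)`
    let Φ : C(↥(leftHandDisc (𝓡∂ (n + 1)) g ξ p₀ (cutLevel n (j + 1))), OnePoint (EuclideanSpace ℝ (Fin (j + 1)))) :=
      (Δ p₀').map.comp (inclDU p₀)
    have hmemP : ∀ w : ↥(leftHandDisc (𝓡∂ (n + 1)) g ξ p₀ (cutLevel n (j + 1))), inclDU p₀ w ∈ ((Δ p₀').T).P → w = v₀ := by
      intro w hw
      have hws : inclDU p₀ w ∈ (Δ p₀').stable := hstable (hDU p₀ w.2) w.2.1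
      have h := (Δ p₀').eq_centre _ hws hw
      have h' : (w : (Cobordism.ofClosed n X).W) = p₀ := (congrArg Subtype.val h).trans hm0
      exact Subtype.ext h'
    have hΦ : MapsTo Φ ({v₀}ᶜ : Set _) {(↑(0 : EuclideanSpace ℝ (Fin (j + 1))) : OnePoint _)}ᶜ := by
      intro w hw h
      exact hw (hmemP w (((Δ p₀').apply_eq_iff _).1 h))
    have hfac : Λ (d p₀) = relativeSingularHomology.map F F Φ hΦ (j + 1)
        (relativeSingularHomology.map F F (ContinuousMap.id _) (mapsTo_id_leftHandSphere_compl v₀ hv₀a) (j + 1) (γ p₀)) := by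
      have h : relativeSingularHomology.map F F (inclDU p₀) (hinclA p₀) (j + 1) ≫
          relativeSingularHomology.map F F (ContinuousMap.id ↥({z : (Cobordism.ofClosed n X).W | g z < cutLevel n (j + 1 + 1)})) hlam (j + 1) ≫
            relativeSingularHomology.map F F (Δ p₀').map hgr (j + 1) =
          relativeSingularHomology.map F F (ContinuousMap.id _) (mapsTo_id_leftHandSphere_compl v₀ hv₀a) (j + 1) ≫
            relativeSingularHomology.map F F Φ hΦ (j + 1) := by
        rw [← relativeSingularHomology.map_comp, ← relativeSingularHomology.map_comp,
          ← relativeSingularHomology.map_comp]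
        exact relativeSingularHomology.map_congr F F (by ext w; rfl) _ _ (j + 1)
      have h' := LinearMap.congr_fun (congrArg ModuleCat.Hom.hom h) (γ p₀)
      simp only [ModuleCat.hom_comp, LinearMap.coe_comp, Function.comp_apply] at h'
      exact h'
    -- `Φ` is injective on local homology at `v₀`: through `L = D_L(p₀)` in `({z : (Cobordism.ofClosed n X).W | g z < cutLevel n (j + 1 + 1)})` and the collapse theorem
    have hLm : ((Δ p₀').T).disc ⊆ (Δ p₀').stable := (Δ p₀').disc_subset
    have hLP : ∀ u : ↥((Δ p₀').stable), (u : ↥({z : (Cobordism.ofClosed n X).W | g z < cutLevel n (j + 1 + 1)})) ∈ ((Δ p₀').T).P →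
        u = ⟨((Δ p₀').T).m 0, hLm ((Δ p₀').T).centre.2⟩ :=
      fun u hu => Subtype.ext ((Δ p₀').eq_centre _ u.2 hu)
    have hmt := TransverseDiscDatum.mapsTo_compl_of_apply_eq_iff (Δ p₀').apply_eq_iff hLP
    have hcoll : IsIso (relativeSingularHomology.map F F ((Δ p₀').map.comp (subsetIncl (Δ p₀').stable)) hmt (j + 1)) :=
      TransverseDiscDatum.isIso_localHomology_map_collapse F F ((Δ p₀').T) (Δ p₀').map
        (Δ p₀').isOpen_V (Δ p₀').P_subset_V (Δ p₀').eq_on_V (Δ p₀').apply_eq_iff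
        (Δ p₀').mapsTo_m (Δ p₀').K_m hLm (Δ p₀').disc_mem_nhdsWithin hLP (j + 1)
    let pL : ↥((Δ p₀').stable) := ⟨((Δ p₀').T).m 0, hLm ((Δ p₀').T).centre.2⟩
    -- `e_DL : D_L(p₀) → L`
    let eDL : C(↥(leftHandDisc (𝓡∂ (n + 1)) g ξ p₀ (cutLevel n (j + 1))), ↥((Δ p₀').stable)) :=
      ⟨fun w => ⟨inclDU p₀ w, hstable (hDU p₀ w.2) w.2.1⟩, ((inclDU p₀).continuous).subtype_mk _⟩
    have heDLv : eDL v₀ = pL := by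
      apply Subtype.ext; apply Subtype.ext
      exact hm0.symm
    have heDL : MapsTo eDL ({v₀}ᶜ : Set _) ({pL}ᶜ : Set ↥((Δ p₀').stable)) := by
      intro w hw h
      apply hw
      rw [mem_singleton_iff] at h ⊢
      have h' : (w : (Cobordism.ofClosed n X).W) = p₀ :=
        (congrArg (fun u : ↥((Δ p₀').stable) => ((u : ↥({z : (Cobordism.ofClosed n X).W | g z < cutLevel n (j + 1 + 1)})) : (Cobordism.ofClosed n X).W)) h).trans hm0
      exact Subtype.ext h'
    have hΦfac : relativeSingularHomology.map F F Φ hΦ (j + 1) =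
        relativeSingularHomology.map F F eDL heDL (j + 1) ≫
          relativeSingularHomology.map F F ((Δ p₀').map.comp (subsetIncl (Δ p₀').stable)) hmt (j + 1) := by
      rw [← relativeSingularHomology.map_comp F F eDL ((Δ p₀').map.comp (subsetIncl (Δ p₀').stable))]
      exact relativeSingularHomology.map_congr F F (by ext w; rfl) _ _ (j + 1)
    -- `e_DL` is an isomorphism on local homology at `v₀`
    have heDLiso : IsIso (relativeSingularHomology.map F F eDL heDL (j + 1)) := by
      set S : Set ↥({z : (Cobordism.ofClosed n X).W | g z < cutLevel n (j + 1 + 1)}) := Subtype.val ⁻¹' leftHandDisc (𝓡∂ (n + 1)) g ξ p₀ (cutLevel n (j + 1)) with hS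
      have hSL : S ⊆ (Δ p₀').stable := fun u hu => hstable u.2 hu.1
      let eS : ↥(leftHandDisc (𝓡∂ (n + 1)) g ξ p₀ (cutLevel n (j + 1))) ≃ₜ ↥S := (preimageValHomeomorphOfSubset (hDU p₀)).symm
      have hpS : ((pL : ↥((Δ p₀').stable)) : ↥({z : (Cobordism.ofClosed n X).W | g z < cutLevel n (j + 1 + 1)})) ∈ S := by
        show ((((Δ p₀').T).m 0 : ↥({z : (Cobordism.ofClosed n X).W | g z < cutLevel n (j + 1 + 1)})) : (Cobordism.ofClosed n X).W) ∈ leftHandDisc (𝓡∂ (n + 1)) g ξ p₀ (cutLevel n (j + 1))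
        rw [hm0]; exact hp₀D
      have hSnhds : S ∈ 𝓝[(Δ p₀').stable] ((pL : ↥((Δ p₀').stable)) : ↥({z : (Cobordism.ofClosed n X).W | g z < cutLevel n (j + 1 + 1)})) := by
        have hO : IsOpen {u : ↥({z : (Cobordism.ofClosed n X).W | g z < cutLevel n (j + 1 + 1)}) | (cutLevel n (j + 1)) < g u} := isOpen_lt continuous_const (hgc.comp continuous_subtype_val)
        have hpO : ((pL : ↥((Δ p₀').stable)) : ↥({z : (Cobordism.ofClosed n X).W | g z < cutLevel n (j + 1 + 1)})) ∈ {u : ↥({z : (Cobordism.ofClosed n X).W | g z < cutLevel n (j + 1 + 1)}) | (cutLevel n (j + 1)) < g u} := by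
          show (cutLevel n (j + 1)) < g ((((Δ p₀').T).m 0 : ↥({z : (Cobordism.ofClosed n X).W | g z < cutLevel n (j + 1 + 1)})) : (Cobordism.ofClosed n X).W)
          rw [hm0]; exact ha0p
        refine mem_nhdsWithin.2 ⟨_, hO, hpO, ?_⟩
        rintro u ⟨hu, huL⟩
        exact ⟨hstable' huL, show (cutLevel n (j + 1)) ≤ g u from le_of_lt hu⟩
      have hι₁ : MapsTo (eS : C(↥(leftHandDisc (𝓡∂ (n + 1)) g ξ p₀ (cutLevel n (j + 1))), ↥S)) ({v₀}ᶜ : Set _) ({⟨(pL : ↥({z : (Cobordism.ofClosed n X).W | g z < cutLevel n (j + 1 + 1)})), hpS⟩}ᶜ : Set ↥S) := by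
        intro w hw h
        apply hw
        rw [mem_singleton_iff] at h ⊢
        have h1 : (w : (Cobordism.ofClosed n X).W) = p₀ :=
          (congrArg (fun u : ↥S => ((u : ↥({z : (Cobordism.ofClosed n X).W | g z < cutLevel n (j + 1 + 1)})) : (Cobordism.ofClosed n X).W)) h).trans hm0
        exact Subtype.ext h1
      have hι₁' : MapsTo (eS.symm : C(↥S, _)) ({⟨(pL : ↥({z : (Cobordism.ofClosed n X).W | g z < cutLevel n (j + 1 + 1)})), hpS⟩}ᶜ : Set ↥S) ({v₀}ᶜ : Set _) := by
        intro u hu h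
        apply hu
        rw [mem_singleton_iff] at h ⊢
        have h1 : ((u : ↥({z : (Cobordism.ofClosed n X).W | g z < cutLevel n (j + 1 + 1)})) : (Cobordism.ofClosed n X).W) = p₀ :=
          congrArg (fun w : ↥(leftHandDisc (𝓡∂ (n + 1)) g ξ p₀ (cutLevel n (j + 1))) => (w : (Cobordism.ofClosed n X).W)) h
        apply Subtype.ext; apply Subtype.ext
        exact h1.trans hm0.symm
      have hι₂ : MapsTo (subsetInclusion hSL) ({⟨(pL : ↥({z : (Cobordism.ofClosed n X).W | g z < cutLevel n (j + 1 + 1)})), hpS⟩}ᶜ : Set ↥S) ({pL}ᶜ : Set ↥((Δ p₀').stable)) := by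
        intro u hu h
        apply hu
        rw [mem_singleton_iff] at h ⊢
        exact Subtype.ext (congrArg Subtype.val h :)
      haveI := relativeSingularHomology.isIso_map_homeomorph F F eS hι₁ hι₁' (j + 1)
      haveI := localHomology.isIso_map_subsetInclusion_of_mem_nhdsWithin_coeff F F hSL hpS hSnhds (j + 1) hι₂
      have hfac2 : relativeSingularHomology.map F F eDL heDL (j + 1) =
          relativeSingularHomology.map F F (eS : C(↥(leftHandDisc (𝓡∂ (n + 1)) g ξ p₀ (cutLevel n (j + 1))), ↥S)) hι₁ (j + 1) ≫
            relativeSingularHomology.map F F (subsetInclusion hSL) hι₂ (j + 1) := by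
        rw [← relativeSingularHomology.map_comp F F (eS : C(↥(leftHandDisc (𝓡∂ (n + 1)) g ξ p₀ (cutLevel n (j + 1))), ↥S)) (subsetInclusion hSL)]
        exact relativeSingularHomology.map_congr F F (by ext w; rfl) _ _ (j + 1)
      rw [hfac2]
      infer_instance
    haveI := heDLiso
    haveI := hcoll
    have hΦinj : Function.Injective (relativeSingularHomology.map F F Φ hΦ (j + 1)) := by
      rw [hΦfac]
      exact ((asIso (relativeSingularHomology.map F F eDL heDL (j + 1))).toLinearEquiv.trans
        (asIso (relativeSingularHomology.map F F ((Δ p₀').map.comp (subsetIncl (Δ p₀').stable)) hmt (j + 1))).toLinearEquiv).injective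
    -- `γ p₀ ≠ 0`
    have hγ0 : γ p₀ ≠ 0 := by
      intro h0
      apply e.ne_zero p₀
      rw [← hγ p₀, h0, map_zero]
    rw [hfac]
    intro h0
    have h1 := hΦinj (h0.trans (map_zero _).symm)
    exact hγ0 (hbij.1 (h1.trans (map_zero _).symm))
  -- ### conclusion
  refine ⟨p₀', fun h0 => ?_⟩
  have hB : Λ y ≠ 0 := by
    rw [hyd, map_sum, Finset.sum_eq_single p₀]
    · rw [map_smul]
      exact smul_ne_zero hp₀ hmain
    · intro p _ hp
      rw [map_smul, hkill p hp, smul_zero]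
    · intro h; exact absurd (Finset.mem_univ p₀) h
  apply hB
  rw [hA, h0, map_zero]

end Cobordism

end Literature.Topology.FourManifolds

end
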